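import Summits.QuantumFields.BalabanUV.Beta.D1BFx.RoadEndBFxRecutSpineDictS
import Summits.QuantumFields.BalabanUV.Beta.D1BFx.RoadEndBFxDictPointwiseS

/-!
# `BalabanUV.Beta.D1BFx.RoadEndBFxRecutDictPointwiseS` — road «BF-x» for binder row D1, PER-WORD lane: the per-word END's ONE (K) row `hdict` IN POINTWISE CURRENCY
# («DICT-PTW-WORD») — the per-word twin of the owner's «DICT-PTW» `RoadEndBFxDictPointwiseS` (p306436)

HONEST DEPENDENCY (page 1, mandatory): continuum YM on T⁴ ⇐ BetaPertH ∧ nine spine estimates (0/9 proved); BetaPertH ⇐ (D1) ∧ (D4) ∧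
CAP+tail; G-an2-4 gates asym, D1 and NE2/3/4.  HONEST FRAMING (cell contract, verbatim): «discharging `BetaPertH` makes Bałaban's UV
stability UNCONDITIONAL — a real constructive-QFT result; it is NOT the continuum limit and NOT the Clay problem.»  THIS MODULE DISCHARGES
NOTHING of the wall: [folklore] composition BY NAME of my per-word junction ENDs `RoadEndBFxRecutSpineDictS` (p306385) with the owner's
lane-independent lemma `RoadEndBFxDictPointwiseS.hdict_of_pointwise` (p306436).  No `def`, no `Prop` mirror,
no cited fact, 0 sorry.  0 root-level binders discharged (hW ∕ hR-sockets ∕ hSX-socket ∕ D1Tel ∕ D1Rep = 0); NOT (K), NOT D1, NOT `BetaPertH`, NOT continuum, NOT Clay.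

ABSOLUTE RULE (cell charter, verbatim): «No internally-minted statement may enter as a cited fact. Every hypothesis is either kernel-proved in
this package or a verbatim quotation of a PUBLISHED theorem with page reference. The manuscript(s) under audit are NOT citable for their own
disputed steps — they are the thing under adjudication; programme-internal (2001/route/tribunal) claims are never citable.»

WHY (owner d1-p2 gen 14, [D1P2-G14-ONLINE] ∕ [D1P2-G14-LANDED-1]; leaf-01 g19 «DICT-PTW-MEAN» is the mean-lane twin).  Every dictionary brick in the tree —
in particular the (A1) identity `KCombineCovStripped.hessKer_transfer_road_cov_stripped` — is an identity of KERNELS, pointwise in the separation `z`;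
the owner's `hdict_of_pointwise` reads the (1.22)-moment row `hdict` off ONE pointwise identity per one-shot scale (`hptw`) plus unit-class moment rows on
NAMED rest kernels (`hMR`, `hRu`, `hU₁`), the gluon and ghost terms being well-typed (1.22)-kernels from the END's own rows (`absMoment₂_gluon_of_prop12`,
`absMoment₂_PghQ`).  This file docks that lemma on the per-word lane: the three per-word ENDs with `hdict` REPLACED IN PLACE by the owner's pointwise rows,
LETTER FOR LETTER, every other binder BYTE-IDENTICAL.

CONTENT.
* §1 [folklore] **`d1Drift_BFx_recut_of_D1Sum_ptw_sbpS`** — `RoadEndBFxRecutSpineDictS.d1Drift_BFx_recut_of_D1Sum_dict_sbpS` with `(hdict)` ↦ `(Rk) {CU'} (hptw) (hMR) (hRu) (hU₁)` ⊢ `D1Drift Lc Js N μ ν`.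
* §2 [folklore] **`d1Rep_BFx_recut_of_D1Sum_ptw_sbpS`** — the same over `…of_D1Sum_dict_sbpS` ⊢ `D1Rep Lc Jc N μ ν a SL k`.
* §3 [folklore] **`d1Rep_BFx_recut_of_D1Tel_ptw_sbpS`** — the same over `…of_D1Tel_dict_sbpS` (the spine root's own binder names `hW`∕`hRfl`∕`htel`) ⊢ `D1Rep Lc Jc N μ ν a SL k`.
Unit `b2b-balaban-beta-d1-formalise-leaf-04` (gen 16), D1 formalisation swarm, per-word lane; journal INTENT 2 [D1LEAF04-G16-X4-INTENT-2]; `LEAVES-BFx.md` row «DICT-PTW-WORD».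
-/

noncomputable section

open Finset Filter Topology
open scoped BigOperators
open Literature.MathematicalPhysics.QuantumFieldTheory.Balaban1983to89
open Literature.MathematicalPhysics.QuantumFieldTheory.Balaban1983to89.Beta
open OneStepResolventKernel (JetData)
open OneStepKernelFamily (TbalOf TshotOf flipK D1Tel D1Rep D1Drift)
open PolarizationSign (WardTransversal AxisReflectionCovariant)
open StepDriftWitness (D1Sum)
open WindowIdentification (fullSum)
open DyadicShell (Pt supNorm)
open ExpKernelCalculus (Site BiLoc shiftK)
open DecimatedMomentSummable (AbsMoment₂)
open BubbleTransfer (unitVec)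
open DressedMomentNormalisation (resSite)
open VectorTailsLoc (fam kfam)
open Summit.QuantumFields.BalabanUV.Beta.TameKernelCalculus (Spr)
open Summit.QuantumFields.BalabanUV.Beta.D1BFx.GluonLeg (Ga)
open Summit.QuantumFields.BalabanUV.Beta.D1BFx.ReducedKernel (TableR TOfRed)
open Summit.QuantumFields.BalabanUV.Beta.D1BFx.DressedTadpoleTable (tableRed)
open Summit.QuantumFields.BalabanUV.Beta.D1BFx.ReducedKernelSandwich (fineHess)
open Summit.QuantumFields.BalabanUV.Beta.D1BFx.FineStencilBFBalaban (SbfBal)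
open Summit.QuantumFields.BalabanUV.Beta.D1BFx.SecondStencilBF (Wbf)
open Summit.QuantumFields.BalabanUV.Beta.D1BFx.GhostKernelComplete (PghQ fineHessGhQ)
open Summit.QuantumFields.BalabanUV.Beta.D1BFx.FrozenLegProfile (gfrz)
open Summit.QuantumFields.BalabanUV.Beta.D1BFx.SplitInstance (RestIdx)
open Summit.QuantumFields.BalabanUV.Beta.D1BFx.SplitInstanceS (restKS)
open Summit.QuantumFields.BalabanUV.Beta.D1BFx.RoadEndBFxRecut (cornerIdx)
open Summit.QuantumFields.BalabanUV.Beta.D1BFx.FrozenLegTails (nOf MOf hn1)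
open Summit.QuantumFields.BalabanUV.Beta.D1BFx.RoadEndBFxDictPointwiseS (hdict_of_pointwise)
open Summit.QuantumFields.BalabanUV.Beta.D1BFx.RoadEndBFxRecutSpineDictS (d1Drift_BFx_recut_of_D1Sum_dict_sbpS d1Rep_BFx_recut_of_D1Sum_dict_sbpS d1Rep_BFx_recut_of_D1Tel_dict_sbpS)

namespace Summit.QuantumFields.BalabanUV.Beta.D1BFx.RoadEndBFxRecutDictPointwiseS

variable {Lc : ℕ} [NeZero Lc] {a N : ℝ} {μ ν : Fin 4} {υ : Type*} [Fintype υ]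
  {cE cVH cΛ cR cK cQ cgh cE₂ cJ4 cΛ₂ cR₂ cQ₂ x₀ ωgl ωgh : ℕ → ℝ} {WE WJ WΛ WR WQ : ℕ → TableR} {CE CJ CΛ CRt CQ δW : ℕ → ℝ}
  {Ru : υ → ℕ → ℝ} {CU : υ → ℝ} {CR : RestIdx → ℝ} {U₁ : ℝ}

/-! ## §1 `D1Drift` over `D1Sum` + the pointwise dictionary rows (per-word END) -/

/-- [folklore] **ROAD BF-x, PER-WORD END OVER `D1Sum`, THE (K) ROW IN POINTWISE CURRENCY.**  `RoadEndBFxRecutSpineDictS.d1Drift_BFx_recut_of_D1Sum_dict_sbpS` with its ONE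
moment row `hdict` REPLACED by the owner's pointwise rows of `RoadEndBFxDictPointwiseS.hdict_of_pointwise`: rest-word KERNELS `Rk u n`, the pointwise identity
`hptw` (at every one-shot scale `n = Lc^m`, `m ≥ 1`, entry by entry in `z`: the spine's `TshotOf Lc Jc m μ ν z` IS `ωgl n·TOfRed … μ ν z + ωgh n·PghQ … μ ν z + Σ_u Rk u n μ ν z`),
`hMR` (`AbsMoment₂` of the rest kernels' channel), `hRu` (read-out slack `|M₂[Rk u n] − Ru u n| ≤ CU′ u`), `hU₁` (`Σ_u CU′ u ≤ U₁`).  Every other binder BYTE-IDENTICAL.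
Body: ONE call with `hdict_of_pointwise …` in the `hdict` slot.  HONEST: composition BY NAME; `hptw`∕`hMR`∕`hRu`∕`hU₁`, `hsum`, every socket∕row∕`h12`∕`h126` are
HYPOTHESES; 0 root-level binders discharged; (K) NOT closed; NOT D1, NOT `BetaPertH`, NOT continuum, NOT Clay. -/
theorem d1Drift_BFx_recut_of_D1Sum_ptw_sbpS (Js : ℕ → JetData 3 Lc) (hμν : μ ≠ ν) (hN : N ≠ 0) (hL : 2 ≤ Lc) (hodd : Odd Lc) (ha : 0 < a)
    -- the two PRINTED statements, by name, for the family scale × even cubic volumes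
    (h12 : B5.Prop12Printed (fam nOf hn1 MOf a ha)) (h126 : B5.Kernel126_127Printed (kfam nOf MOf))
    -- bridge B1 REPLACED: composite jet data + the telescoping binder; then the ONE dictionary row
    (Jc : ∀ m : ℕ, JetData 3 (Lc ^ m)) (hsum : D1Sum Lc Js Jc μ ν)
    -- THE (K) SLOT IN POINTWISE CURRENCY: rest-word kernels `Rk`, the pointwise dictionary `hptw`, the rest kernels' moments and their read-out slack
    (Rk : υ → ℕ → Fin 4 → Fin 4 → Site 4 → ℝ) {CU' : υ → ℝ}
    (hptw : ∀ m : ℕ, 1 ≤ m → ∀ z : Site 4, TshotOf Lc Jc m μ ν z =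
      ωgl (Lc ^ m) * TOfRed (Lc ^ m) a
          (SbfBal (Lc ^ m) a (cE (Lc ^ m)) (cVH (Lc ^ m)) (cΛ (Lc ^ m)) (cR (Lc ^ m)) (cK (Lc ^ m)) (cQ (Lc ^ m)))
          (tableRed (Lc ^ m) (Wbf (cE₂ (Lc ^ m)) (cJ4 (Lc ^ m)) (cΛ₂ (Lc ^ m)) (cR₂ (Lc ^ m)) (cQ₂ (Lc ^ m))
            (WE (Lc ^ m)) (WJ (Lc ^ m)) (WΛ (Lc ^ m)) (WR (Lc ^ m)) (WQ (Lc ^ m)))) μ ν z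
        + ωgh (Lc ^ m) * PghQ (Lc ^ m) a (x₀ (Lc ^ m)) (cK (Lc ^ m)) (cQ (Lc ^ m)) μ ν z
        + ∑ u, Rk u (Lc ^ m) μ ν z)
    (hMR : ∀ (u : υ) (m : ℕ), 1 ≤ m → AbsMoment₂ (Rk u (Lc ^ m) μ ν))
    (hRu : ∀ (u : υ) (m : ℕ), 1 ≤ m → |B12Beta.secondMoment (Rk u (Lc ^ m)) μ ν - Ru u (Lc ^ m)| ≤ CU' u)
    (hU₁ : ∑ u, CU' u ≤ U₁)
    (s : ℕ → ℝ) (hωs : ∀ n : ℕ, 2 ≤ n → ωgh n * (s n * cK n) ^ 2 = -2 * (ωgl n * cE n ^ 2))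
    (hlam : ∀ n : ℕ, 2 ≤ n → ωgl n * cE n ^ 2 = 2 * N ^ 2 * (n : ℝ) ^ 8)
    -- slot-table sockets
    (hδW : ∀ n, 0 < δW n)
    (hE : ∀ n κ u l u', BiLoc (WE n κ u l u') u u' (CE n) (δW n)) (hJ : ∀ n κ u l u', BiLoc (WJ n κ u l u') u u' (CJ n) (δW n))
    (hΛ : ∀ n κ u l u', BiLoc (WΛ n κ u l u') u u' (CΛ n) (δW n)) (hR : ∀ n κ u l u', BiLoc (WR n κ u l u') u u' (CRt n) (δW n))
    (hQ : ∀ n κ u l u', BiLoc (WQ n κ u l u') u u' (CQ n) (δW n))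
    (hEc : ∀ (n : ℕ) (κ : Fin 4) (u : Site 4) (l : Fin 4) (u' t : Site 4),
      WE n κ (u + (n : ℤ) • t) l (u' + (n : ℤ) • t) = shiftK (-((n : ℤ) • t)) (WE n κ u l u'))
    (hJc : ∀ (n : ℕ) (κ : Fin 4) (u : Site 4) (l : Fin 4) (u' t : Site 4),
      WJ n κ (u + (n : ℤ) • t) l (u' + (n : ℤ) • t) = shiftK (-((n : ℤ) • t)) (WJ n κ u l u'))
    (hΛc : ∀ (n : ℕ) (κ : Fin 4) (u : Site 4) (l : Fin 4) (u' t : Site 4),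
      WΛ n κ (u + (n : ℤ) • t) l (u' + (n : ℤ) • t) = shiftK (-((n : ℤ) • t)) (WΛ n κ u l u'))
    (hRc : ∀ (n : ℕ) (κ : Fin 4) (u : Site 4) (l : Fin 4) (u' t : Site 4),
      WR n κ (u + (n : ℤ) • t) l (u' + (n : ℤ) • t) = shiftK (-((n : ℤ) • t)) (WR n κ u l u'))
    (hQc : ∀ (n : ℕ) (κ : Fin 4) (u : Site 4) (l : Fin 4) (u' t : Site 4),
      WQ n κ (u + (n : ℤ) • t) l (u' + (n : ℤ) • t) = shiftK (-((n : ℤ) • t)) (WQ n κ u l u'))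
    (hEs : ∀ n κ u l u', WE n κ u l u' = WE n l u' κ u) (hJs : ∀ n κ u l u', WJ n κ u l u' = WJ n l u' κ u)
    (hΛs : ∀ n κ u l u', WΛ n κ u l u' = WΛ n l u' κ u) (hRs : ∀ n κ u l u', WR n κ u l u' = WR n l u' κ u)
    (hQs : ∀ n κ u l u', WQ n κ u l u' = WQ n l u' κ u)
    -- first-bond divergence-freeness of the gluon fine Hessian kernel; the ghost Ward rows
    (hdiv : ∀ n : ℕ, 2 ≤ n → ∀ [NeZero n], ∀ (l' : Fin 4) (u' u : Site 4), ∑ κ' : Fin 4,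
      (fineHess n a (SbfBal n a (cE n) (cVH n) (cΛ n) (cR n) (cK n) (cQ n))
          (Wbf (cE₂ n) (cJ4 n) (cΛ₂ n) (cR₂ n) (cQ₂ n) (WE n) (WJ n) (WΛ n) (WR n) (WQ n)) κ' l' (u - Pi.single κ' 1) u'
        - fineHess n a (SbfBal n a (cE n) (cVH n) (cΛ n) (cR n) (cK n) (cQ n))
          (Wbf (cE₂ n) (cJ4 n) (cΛ₂ n) (cR₂ n) (cQ₂ n) (WE n) (WJ n) (WΛ n) (WR n) (WQ n)) κ' l' u u') = 0)
    (hrowgh : ∀ n : ℕ, 2 ≤ n → ∀ [NeZero n], ∀ (κ' l' : Fin 4) (b : Site 4), HasSum (fineHessGhQ n a (x₀ n) (cK n) (cQ n) κ' l' b) 0)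
    -- (REST′) for the re-cut words other than the corner, n-UNIFORM; (U)
    (hRest : ∀ n : ℕ, 2 ≤ n → ∀ [NeZero n], ∀ τ : RestIdx, τ ≠ cornerIdx →
      |∑ b ∈ (univ : Finset (Fin 4 → Fin n)).image resSite, ((n : ℝ) ^ 4)⁻¹ *
        fullSum (fun w : Pt => restKS n a (gfrz n a b) (fun v => s n * gfrz n a b v) (cE n) (cΛ n) (cR n) (cK n) (cQ n) (cE₂ n) (cJ4 n) (cΛ₂ n) (cR₂ n) (cQ₂ n) (x₀ n)
          (WE n) (WJ n) (WΛ n) (WR n) (WQ n) (ωgl n) (ωgh n) ((n : ℝ) ^ 8) N μ ν b τ w)| ≤ CR τ)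
    (hU : ∀ n : ℕ, 2 ≤ n → ∀ u, |Ru u n| ≤ CU u) :
    D1Drift Lc Js N μ ν :=
  d1Drift_BFx_recut_of_D1Sum_dict_sbpS
    Js hμν hN hL hodd ha h12 h126 Jc hsum (hdict_of_pointwise hL ha h12 h126 Jc hδW hE hJ hΛ hR hQ Rk hptw hMR hRu hU₁) s hωs hlam hδW hE hJ hΛ hR hQ
    hEc hJc hΛc hRc hQc hEs hJs hΛs hRs hQs hdiv hrowgh hRest hU

/-! ## §2–§3 The per-word road SUPPLIES the spine's `D1Rep` over the pointwise dictionary rows -/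

/-- [folklore] **PER-WORD ROAD BF-x ⟹ THE SPINE's `D1Rep`, POINTWISE-DICTIONARY FORM** — `RoadEndBFxRecutSpineDictS.d1Rep_BFx_recut_of_D1Sum_dict_sbpS` with `(hdict)` ↦
`(Rk) {CU'} (hptw) (hMR) (hRu) (hU₁)`.  HONEST: as §1. -/
theorem d1Rep_BFx_recut_of_D1Sum_ptw_sbpS (Js : ℕ → JetData 3 Lc) (hμν : μ ≠ ν) (hN : N ≠ 0) (hL : 2 ≤ Lc) (hodd : Odd Lc) (ha : 0 < a)
    -- the two PRINTED statements, by name, for the family scale × even cubic volumes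
    (h12 : B5.Prop12Printed (fam nOf hn1 MOf a ha)) (h126 : B5.Kernel126_127Printed (kfam nOf MOf))
    -- bridge B1 REPLACED: composite jet data + the telescoping binder; then the ONE dictionary row
    (Jc : ∀ m : ℕ, JetData 3 (Lc ^ m)) (hsum : D1Sum Lc Js Jc μ ν)
    -- THE (K) SLOT IN POINTWISE CURRENCY: rest-word kernels `Rk`, the pointwise dictionary `hptw`, the rest kernels' moments and their read-out slack
    (Rk : υ → ℕ → Fin 4 → Fin 4 → Site 4 → ℝ) {CU' : υ → ℝ}
    (hptw : ∀ m : ℕ, 1 ≤ m → ∀ z : Site 4, TshotOf Lc Jc m μ ν z =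
      ωgl (Lc ^ m) * TOfRed (Lc ^ m) a
          (SbfBal (Lc ^ m) a (cE (Lc ^ m)) (cVH (Lc ^ m)) (cΛ (Lc ^ m)) (cR (Lc ^ m)) (cK (Lc ^ m)) (cQ (Lc ^ m)))
          (tableRed (Lc ^ m) (Wbf (cE₂ (Lc ^ m)) (cJ4 (Lc ^ m)) (cΛ₂ (Lc ^ m)) (cR₂ (Lc ^ m)) (cQ₂ (Lc ^ m))
            (WE (Lc ^ m)) (WJ (Lc ^ m)) (WΛ (Lc ^ m)) (WR (Lc ^ m)) (WQ (Lc ^ m)))) μ ν z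
        + ωgh (Lc ^ m) * PghQ (Lc ^ m) a (x₀ (Lc ^ m)) (cK (Lc ^ m)) (cQ (Lc ^ m)) μ ν z
        + ∑ u, Rk u (Lc ^ m) μ ν z)
    (hMR : ∀ (u : υ) (m : ℕ), 1 ≤ m → AbsMoment₂ (Rk u (Lc ^ m) μ ν))
    (hRu : ∀ (u : υ) (m : ℕ), 1 ≤ m → |B12Beta.secondMoment (Rk u (Lc ^ m)) μ ν - Ru u (Lc ^ m)| ≤ CU' u)
    (hU₁ : ∑ u, CU' u ≤ U₁)
    (s : ℕ → ℝ) (hωs : ∀ n : ℕ, 2 ≤ n → ωgh n * (s n * cK n) ^ 2 = -2 * (ωgl n * cE n ^ 2))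
    (hlam : ∀ n : ℕ, 2 ≤ n → ωgl n * cE n ^ 2 = 2 * N ^ 2 * (n : ℝ) ^ 8)
    -- slot-table sockets
    (hδW : ∀ n, 0 < δW n)
    (hE : ∀ n κ u l u', BiLoc (WE n κ u l u') u u' (CE n) (δW n)) (hJ : ∀ n κ u l u', BiLoc (WJ n κ u l u') u u' (CJ n) (δW n))
    (hΛ : ∀ n κ u l u', BiLoc (WΛ n κ u l u') u u' (CΛ n) (δW n)) (hR : ∀ n κ u l u', BiLoc (WR n κ u l u') u u' (CRt n) (δW n))
    (hQ : ∀ n κ u l u', BiLoc (WQ n κ u l u') u u' (CQ n) (δW n))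
    (hEc : ∀ (n : ℕ) (κ : Fin 4) (u : Site 4) (l : Fin 4) (u' t : Site 4),
      WE n κ (u + (n : ℤ) • t) l (u' + (n : ℤ) • t) = shiftK (-((n : ℤ) • t)) (WE n κ u l u'))
    (hJc : ∀ (n : ℕ) (κ : Fin 4) (u : Site 4) (l : Fin 4) (u' t : Site 4),
      WJ n κ (u + (n : ℤ) • t) l (u' + (n : ℤ) • t) = shiftK (-((n : ℤ) • t)) (WJ n κ u l u'))
    (hΛc : ∀ (n : ℕ) (κ : Fin 4) (u : Site 4) (l : Fin 4) (u' t : Site 4),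
      WΛ n κ (u + (n : ℤ) • t) l (u' + (n : ℤ) • t) = shiftK (-((n : ℤ) • t)) (WΛ n κ u l u'))
    (hRc : ∀ (n : ℕ) (κ : Fin 4) (u : Site 4) (l : Fin 4) (u' t : Site 4),
      WR n κ (u + (n : ℤ) • t) l (u' + (n : ℤ) • t) = shiftK (-((n : ℤ) • t)) (WR n κ u l u'))
    (hQc : ∀ (n : ℕ) (κ : Fin 4) (u : Site 4) (l : Fin 4) (u' t : Site 4),
      WQ n κ (u + (n : ℤ) • t) l (u' + (n : ℤ) • t) = shiftK (-((n : ℤ) • t)) (WQ n κ u l u'))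
    (hEs : ∀ n κ u l u', WE n κ u l u' = WE n l u' κ u) (hJs : ∀ n κ u l u', WJ n κ u l u' = WJ n l u' κ u)
    (hΛs : ∀ n κ u l u', WΛ n κ u l u' = WΛ n l u' κ u) (hRs : ∀ n κ u l u', WR n κ u l u' = WR n l u' κ u)
    (hQs : ∀ n κ u l u', WQ n κ u l u' = WQ n l u' κ u)
    -- first-bond divergence-freeness of the gluon fine Hessian kernel; the ghost Ward rows
    (hdiv : ∀ n : ℕ, 2 ≤ n → ∀ [NeZero n], ∀ (l' : Fin 4) (u' u : Site 4), ∑ κ' : Fin 4,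
      (fineHess n a (SbfBal n a (cE n) (cVH n) (cΛ n) (cR n) (cK n) (cQ n))
          (Wbf (cE₂ n) (cJ4 n) (cΛ₂ n) (cR₂ n) (cQ₂ n) (WE n) (WJ n) (WΛ n) (WR n) (WQ n)) κ' l' (u - Pi.single κ' 1) u'
        - fineHess n a (SbfBal n a (cE n) (cVH n) (cΛ n) (cR n) (cK n) (cQ n))
          (Wbf (cE₂ n) (cJ4 n) (cΛ₂ n) (cR₂ n) (cQ₂ n) (WE n) (WJ n) (WΛ n) (WR n) (WQ n)) κ' l' u u') = 0)
    (hrowgh : ∀ n : ℕ, 2 ≤ n → ∀ [NeZero n], ∀ (κ' l' : Fin 4) (b : Site 4), HasSum (fineHessGhQ n a (x₀ n) (cK n) (cQ n) κ' l' b) 0)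
    -- (REST′) for the re-cut words other than the corner, n-UNIFORM; (U)
    (hRest : ∀ n : ℕ, 2 ≤ n → ∀ [NeZero n], ∀ τ : RestIdx, τ ≠ cornerIdx →
      |∑ b ∈ (univ : Finset (Fin 4 → Fin n)).image resSite, ((n : ℝ) ^ 4)⁻¹ *
        fullSum (fun w : Pt => restKS n a (gfrz n a b) (fun v => s n * gfrz n a b v) (cE n) (cΛ n) (cR n) (cK n) (cQ n) (cE₂ n) (cJ4 n) (cΛ₂ n) (cR₂ n) (cQ₂ n) (x₀ n)
          (WE n) (WJ n) (WΛ n) (WR n) (WQ n) (ωgl n) (ωgh n) ((n : ℝ) ^ 8) N μ ν b τ w)| ≤ CR τ)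
    (hU : ∀ n : ℕ, 2 ≤ n → ∀ u, |Ru u n| ≤ CU u)
    -- base-point labels of the free one-shot side (the spine root's `hSL` ∕ `k`); the Literature's window data is discharged at `M := id`, `cc := 1`
    {L : Type*} {SL : Finset L} (hSL : SL.Nonempty) (k : L → Fin 4) :
    D1Rep Lc Jc N μ ν a SL k :=
  d1Rep_BFx_recut_of_D1Sum_dict_sbpS
    Js hμν hN hL hodd ha h12 h126 Jc hsum (hdict_of_pointwise hL ha h12 h126 Jc hδW hE hJ hΛ hR hQ Rk hptw hMR hRu hU₁) s hωs hlam hδW hE hJ hΛ hR hQ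
    hEc hJc hΛc hRc hQc hEs hJs hΛs hRs hQs hdiv hrowgh hRest hU hSL k

/-- [folklore] **PER-WORD ROAD BF-x ⟹ THE SPINE's `D1Rep` AT THE SPINE ROOT's OWN BINDER NAMES, POINTWISE-DICTIONARY FORM** —
`RoadEndBFxRecutSpineDictS.d1Rep_BFx_recut_of_D1Tel_dict_sbpS` with `(hdict)` ↦ `(Rk) {CU'} (hptw) (hMR) (hRu) (hU₁)`; telescoping displayed as `hW`∕`hRfl`∕`htel : D1Tel Lc Js Jc`.
READING: the per-word road's END for the spine root now displays, about Bałaban's kernels, ONE POINTWISE IDENTITY per one-shot scale (`hptw`) + unit-class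
moment rows on named rest kernels — the currency of (A1) `KCombineCovStripped.hessKer_transfer_road_cov_stripped`.  HONEST: as §1. -/
theorem d1Rep_BFx_recut_of_D1Tel_ptw_sbpS (Js : ℕ → JetData 3 Lc) (hμν : μ ≠ ν) (hN : N ≠ 0) (hL : 2 ≤ Lc) (hodd : Odd Lc) (ha : 0 < a)
    -- the two PRINTED statements, by name, for the family scale × even cubic volumes
    (h12 : B5.Prop12Printed (fam nOf hn1 MOf a ha)) (h126 : B5.Kernel126_127Printed (kfam nOf MOf))
    -- bridge B1 REPLACED: composite jet data + the telescoping binder; then the ONE dictionary row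
    (Jc : ∀ m : ℕ, JetData 3 (Lc ^ m)) 
    (hW : ∀ j, WardTransversal (flipK (TbalOf Lc Js j))) (hRfl : ∀ j, AxisReflectionCovariant (flipK (TbalOf Lc Js j)))
    (htel : D1Tel Lc Js Jc)
    -- THE (K) SLOT IN POINTWISE CURRENCY: rest-word kernels `Rk`, the pointwise dictionary `hptw`, the rest kernels' moments and their read-out slack
    (Rk : υ → ℕ → Fin 4 → Fin 4 → Site 4 → ℝ) {CU' : υ → ℝ}
    (hptw : ∀ m : ℕ, 1 ≤ m → ∀ z : Site 4, TshotOf Lc Jc m μ ν z =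
      ωgl (Lc ^ m) * TOfRed (Lc ^ m) a
          (SbfBal (Lc ^ m) a (cE (Lc ^ m)) (cVH (Lc ^ m)) (cΛ (Lc ^ m)) (cR (Lc ^ m)) (cK (Lc ^ m)) (cQ (Lc ^ m)))
          (tableRed (Lc ^ m) (Wbf (cE₂ (Lc ^ m)) (cJ4 (Lc ^ m)) (cΛ₂ (Lc ^ m)) (cR₂ (Lc ^ m)) (cQ₂ (Lc ^ m))
            (WE (Lc ^ m)) (WJ (Lc ^ m)) (WΛ (Lc ^ m)) (WR (Lc ^ m)) (WQ (Lc ^ m)))) μ ν z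
        + ωgh (Lc ^ m) * PghQ (Lc ^ m) a (x₀ (Lc ^ m)) (cK (Lc ^ m)) (cQ (Lc ^ m)) μ ν z
        + ∑ u, Rk u (Lc ^ m) μ ν z)
    (hMR : ∀ (u : υ) (m : ℕ), 1 ≤ m → AbsMoment₂ (Rk u (Lc ^ m) μ ν))
    (hRu : ∀ (u : υ) (m : ℕ), 1 ≤ m → |B12Beta.secondMoment (Rk u (Lc ^ m)) μ ν - Ru u (Lc ^ m)| ≤ CU' u)
    (hU₁ : ∑ u, CU' u ≤ U₁)
    (s : ℕ → ℝ) (hωs : ∀ n : ℕ, 2 ≤ n → ωgh n * (s n * cK n) ^ 2 = -2 * (ωgl n * cE n ^ 2))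
    (hlam : ∀ n : ℕ, 2 ≤ n → ωgl n * cE n ^ 2 = 2 * N ^ 2 * (n : ℝ) ^ 8)
    -- slot-table sockets
    (hδW : ∀ n, 0 < δW n)
    (hE : ∀ n κ u l u', BiLoc (WE n κ u l u') u u' (CE n) (δW n)) (hJ : ∀ n κ u l u', BiLoc (WJ n κ u l u') u u' (CJ n) (δW n))
    (hΛ : ∀ n κ u l u', BiLoc (WΛ n κ u l u') u u' (CΛ n) (δW n)) (hR : ∀ n κ u l u', BiLoc (WR n κ u l u') u u' (CRt n) (δW n))
    (hQ : ∀ n κ u l u', BiLoc (WQ n κ u l u') u u' (CQ n) (δW n))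
    (hEc : ∀ (n : ℕ) (κ : Fin 4) (u : Site 4) (l : Fin 4) (u' t : Site 4),
      WE n κ (u + (n : ℤ) • t) l (u' + (n : ℤ) • t) = shiftK (-((n : ℤ) • t)) (WE n κ u l u'))
    (hJc : ∀ (n : ℕ) (κ : Fin 4) (u : Site 4) (l : Fin 4) (u' t : Site 4),
      WJ n κ (u + (n : ℤ) • t) l (u' + (n : ℤ) • t) = shiftK (-((n : ℤ) • t)) (WJ n κ u l u'))
    (hΛc : ∀ (n : ℕ) (κ : Fin 4) (u : Site 4) (l : Fin 4) (u' t : Site 4),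
      WΛ n κ (u + (n : ℤ) • t) l (u' + (n : ℤ) • t) = shiftK (-((n : ℤ) • t)) (WΛ n κ u l u'))
    (hRc : ∀ (n : ℕ) (κ : Fin 4) (u : Site 4) (l : Fin 4) (u' t : Site 4),
      WR n κ (u + (n : ℤ) • t) l (u' + (n : ℤ) • t) = shiftK (-((n : ℤ) • t)) (WR n κ u l u'))
    (hQc : ∀ (n : ℕ) (κ : Fin 4) (u : Site 4) (l : Fin 4) (u' t : Site 4),
      WQ n κ (u + (n : ℤ) • t) l (u' + (n : ℤ) • t) = shiftK (-((n : ℤ) • t)) (WQ n κ u l u'))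
    (hEs : ∀ n κ u l u', WE n κ u l u' = WE n l u' κ u) (hJs : ∀ n κ u l u', WJ n κ u l u' = WJ n l u' κ u)
    (hΛs : ∀ n κ u l u', WΛ n κ u l u' = WΛ n l u' κ u) (hRs : ∀ n κ u l u', WR n κ u l u' = WR n l u' κ u)
    (hQs : ∀ n κ u l u', WQ n κ u l u' = WQ n l u' κ u)
    -- first-bond divergence-freeness of the gluon fine Hessian kernel; the ghost Ward rows
    (hdiv : ∀ n : ℕ, 2 ≤ n → ∀ [NeZero n], ∀ (l' : Fin 4) (u' u : Site 4), ∑ κ' : Fin 4,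
      (fineHess n a (SbfBal n a (cE n) (cVH n) (cΛ n) (cR n) (cK n) (cQ n))
          (Wbf (cE₂ n) (cJ4 n) (cΛ₂ n) (cR₂ n) (cQ₂ n) (WE n) (WJ n) (WΛ n) (WR n) (WQ n)) κ' l' (u - Pi.single κ' 1) u'
        - fineHess n a (SbfBal n a (cE n) (cVH n) (cΛ n) (cR n) (cK n) (cQ n))
          (Wbf (cE₂ n) (cJ4 n) (cΛ₂ n) (cR₂ n) (cQ₂ n) (WE n) (WJ n) (WΛ n) (WR n) (WQ n)) κ' l' u u') = 0)
    (hrowgh : ∀ n : ℕ, 2 ≤ n → ∀ [NeZero n], ∀ (κ' l' : Fin 4) (b : Site 4), HasSum (fineHessGhQ n a (x₀ n) (cK n) (cQ n) κ' l' b) 0)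
    -- (REST′) for the re-cut words other than the corner, n-UNIFORM; (U)
    (hRest : ∀ n : ℕ, 2 ≤ n → ∀ [NeZero n], ∀ τ : RestIdx, τ ≠ cornerIdx →
      |∑ b ∈ (univ : Finset (Fin 4 → Fin n)).image resSite, ((n : ℝ) ^ 4)⁻¹ *
        fullSum (fun w : Pt => restKS n a (gfrz n a b) (fun v => s n * gfrz n a b v) (cE n) (cΛ n) (cR n) (cK n) (cQ n) (cE₂ n) (cJ4 n) (cΛ₂ n) (cR₂ n) (cQ₂ n) (x₀ n)
          (WE n) (WJ n) (WΛ n) (WR n) (WQ n) (ωgl n) (ωgh n) ((n : ℝ) ^ 8) N μ ν b τ w)| ≤ CR τ)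
    (hU : ∀ n : ℕ, 2 ≤ n → ∀ u, |Ru u n| ≤ CU u)
    -- base-point labels of the free one-shot side (the spine root's `hSL` ∕ `k`); the Literature's window data is discharged at `M := id`, `cc := 1`
    {L : Type*} {SL : Finset L} (hSL : SL.Nonempty) (k : L → Fin 4) :
    D1Rep Lc Jc N μ ν a SL k :=
  d1Rep_BFx_recut_of_D1Tel_dict_sbpS
    Js hμν hN hL hodd ha h12 h126 Jc hW hRfl htel (hdict_of_pointwise hL ha h12 h126 Jc hδW hE hJ hΛ hR hQ Rk hptw hMR hRu hU₁) s hωs hlam hδW hE hJ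
    hΛ hR hQ hEc hJc hΛc hRc hQc hEs hJs hΛs hRs hQs hdiv hrowgh hRest hU hSL k

end Summit.QuantumFields.BalabanUV.Beta.D1BFx.RoadEndBFxRecutDictPointwiseS

end
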